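import Summits.QuantumFields.GaugeBoot.FullSpaceGroupBoundsConvergenceZd
import Summits.QuantumFields.GaugeBoot.BootstrapReducedCertificatesZd
import HarnessLib

/-!
# Certificates of the bootstrap reduced by the full space group `B_d ⋉ ℤ^d`: SOS ⊕ loop equations ⊕ symmetry multipliers — sound and complete for the fully symmetric phases (gauge-boot, L1/L4 supplement)

HONEST FRAMING (cell `pub-gaugeboot`, page 1 of every file): the venture produces certified bounds
on lattice expectations at stated coupling, gauge group, dimension and torus size; NOT a mass gap,
NOT a continuum limit, NOT a string tension; NOT Yang–Mills-summit-bearing (barriers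
`FixedCouplingUltralocality`, `PerturbativeInvisibility`). Structural; it certifies no number.

## Content (`SU(N)` on `ℤ^d`, any real `β`, word level `n`)

The dual of the fully reduced SDP `fullSymLevelValuesZdSuN` (`BootstrapReflectionsZd`), parallel to
`BootstrapReducedCertificatesZd` (translations only): a FULLY REDUCED CERTIFICATE for `P ≤ c` at
level `n` is an identity `c • 1 - P = Σ v_j² + Σ λ_l (f_l' - β f_l S_l') + Σ κ_m (w_m ∘ g_m - w_m)` with
SYMMETRY MULTIPLIERS for `g_m` a translation, an axis permutation or an axis reflection and `w_m` of
word length `≤ 2n` (in the reduced SDP `w ∘ g` and `w` are one variable).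

* `spaceGroupDiffZdSuN N n`, ★ `fullCertConeZdSuN N β n` (`= certCone ⊔ spaceGroupDiff`), inside the
  level-`n` certificate domain with `1` an order unit; `translationDiff ≤ spaceGroupDiff`,
  `symCertCone ≤ fullCertCone`;
* ★ `isDualFeasible_fullCertCone_iff_suN` — dual feasibility = the data of `fullSymLevelValuesZdSuN`;
* ★★ SOUNDNESS `le_of_mem_fullCertCone_suN`, `fullDlr_integral_le_of_mem_fullCertCone_suN` — a fully
  reduced certificate bounds every fully reduced value and every Gibbs state with the full lattice
  symmetry (not necessarily the others);
* ★★★ NO GAP `forall_fullSymLevelValuesZd_le_iff_suN`, `exists_fullCertificate_suN` (explicit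
  `σ + ρ + δ`), `sSup_fullSymLevelValuesZd_eq_sInf_suN`;
* ★★★ COMPLETENESS `exists_fullCertificate_of_forall_fullDlr_le_suN` — a polynomial bound strictly
  valid in every Gibbs state with the full lattice symmetry has a fully reduced certificate at some
  level. So: plain certificates ⟷ all Gibbs states; translation multipliers ⟷ homogeneous phases;
  all symmetry multipliers ⟷ fully symmetric phases.

References: V. Kazakov, Z. Zheng, arXiv:2203.11360, arXiv:2404.16925; C. Josz, D. Henrion, Optim.
Lett. 10 (2016) 3. Folklore.
-/

noncomputable section

open MeasureTheory Filter Topology NormedSpace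
open Literature.MathematicalPhysics.QuantumFieldTheory (LatticeRep)
open Literature.MathematicalPhysics.QuantumLattice

namespace Summit.QuantumFields.GaugeBoot

open OrderUnitDuality

section ZdSuN

variable {d : ℕ} (N : ℕ) (β : ℝ)

/-- **The symmetry multipliers' space**: the span of `w ∘ g - w` for `g` a translation, an axis
permutation or an axis reflection (`fullSpaceGroupMaps`) and `w` of word length `≤ 2n`. [folklore] -/
def spaceGroupDiffZdSuN (n : ℕ) :
    Submodule ℝ C(LGConfig d (Matrix.specialUnitaryGroup (Fin N) ℂ), ℝ) :=
  Submodule.span ℝ {x | ∃ R ∈ fullSpaceGroupMaps d N, ∃ w : C(LGConfig d (Matrix.specialUnitaryGroup (Fin N) ℂ), ℝ),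
    w ∈ wordTruncation (ι := ZdEdge d) (fundamentalLatticeRep N) (n + n) ∧ w.comp R - w = x}

/-- ★ **The fully reduced certificate cone**: SOS of level-`n` test functions + level-`n` rows +
symmetry multipliers. [folklore] -/
def fullCertConeZdSuN (n : ℕ) :
    PointedCone ℝ C(LGConfig d (Matrix.specialUnitaryGroup (Fin N) ℂ), ℝ) :=
  certConeZdSuN (d := d) N β n ⊔ (spaceGroupDiffZdSuN (d := d) N n).restrictScalars {c : ℝ // 0 ≤ c}

/-- The plain cone sits inside the fully reduced one. -/
theorem certCone_le_fullCertCone_suN (n : ℕ) :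
    certConeZdSuN (d := d) N β n ≤ fullCertConeZdSuN (d := d) N β n := le_sup_left

/-- Translation multipliers are symmetry multipliers. -/
theorem translationDiff_le_spaceGroupDiff_suN (n : ℕ) :
    translationDiffZdSuN (d := d) N n ≤ spaceGroupDiffZdSuN (d := d) N n := by
  refine Submodule.span_le.2 ?_
  rintro x ⟨a, w, hw, rfl⟩
  exact Submodule.subset_span ⟨_, Or.inl (Or.inl ⟨a, rfl⟩), w, hw, rfl⟩

/-- The translation-reduced cone sits inside the fully reduced one. -/
theorem symCertCone_le_fullCertCone_suN (n : ℕ) :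
    symCertConeZdSuN (d := d) N β n ≤ fullCertConeZdSuN (d := d) N β n :=
  sup_le le_sup_left fun x hx => Submodule.mem_sup_right
    (show x ∈ (spaceGroupDiffZdSuN (d := d) N n).restrictScalars {c : ℝ // 0 ≤ c} from
      translationDiff_le_spaceGroupDiff_suN N n hx)

/-- Symmetry differences are fully reduced certificates (of `0`). -/
theorem mem_fullCertCone_of_mem_spaceGroupDiff_suN {n : ℕ}
    {x : C(LGConfig d (Matrix.specialUnitaryGroup (Fin N) ℂ), ℝ)} (hx : x ∈ spaceGroupDiffZdSuN (d := d) N n) :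
    x ∈ fullCertConeZdSuN (d := d) N β n :=
  Submodule.mem_sup_right hx

/-- Every symmetry map keeps the words of length `≤ m`. -/
theorem comp_mem_wordTruncation_of_mem_fullSpaceGroupMaps (m : ℕ)
    {R : C(LGConfig d (Matrix.specialUnitaryGroup (Fin N) ℂ), LGConfig d (Matrix.specialUnitaryGroup (Fin N) ℂ))}
    (hR : R ∈ fullSpaceGroupMaps d N) {w : C(LGConfig d (Matrix.specialUnitaryGroup (Fin N) ℂ), ℝ)}
    (hw : w ∈ wordTruncation (ι := ZdEdge d) (fundamentalLatticeRep N) m) :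
    w.comp R ∈ wordTruncation (ι := ZdEdge d) (fundamentalLatticeRep N) m := by
  rcases hR with (⟨v, rfl⟩ | ⟨σ, rfl⟩) | ⟨i, rfl⟩
  · exact comp_relabelCM_mem_wordTruncation _ _ hw
  · exact comp_relabelCM_mem_wordTruncation _ _ hw
  · exact comp_zdSiteReflectCM_mem_wordTruncation i _ _ hw

/-- The symmetry multipliers' space lies in the words of length `≤ 2n`. -/
theorem spaceGroupDiff_le_wordTruncation_suN (n : ℕ) :
    ∀ x ∈ spaceGroupDiffZdSuN (d := d) N n, x ∈ wordTruncation (ι := ZdEdge d) (fundamentalLatticeRep N) (n + n) := by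
  intro x hx
  induction hx using Submodule.span_induction with
  | mem y hy =>
    obtain ⟨R, hR, w, hw, rfl⟩ := hy
    exact (Submodule.span ℝ _).sub_mem (comp_mem_wordTruncation_of_mem_fullSpaceGroupMaps N _ hR hw) hw
  | zero => exact (Submodule.span ℝ _).zero_mem
  | add y z _ _ hy hz => exact (Submodule.span ℝ _).add_mem hy hz
  | smul c y _ hy => exact (Submodule.span ℝ _).smul_mem c hy

/-- **The fully reduced cone lives in the level-`n` certificate domain.** -/
theorem fullCertCone_le_certDomain_suN (n : ℕ) :
    ∀ x ∈ fullCertConeZdSuN (d := d) N β n, x ∈ certDomainZdSuN (d := d) N β n := by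
  intro x hx
  obtain ⟨y, hy, z, hz, rfl⟩ := Submodule.mem_sup.1 hx
  exact (certDomainZdSuN (d := d) N β n).add_mem (certCone_le_certDomain _ n y hy)
    (mem_certDomain_of_mem_wordTruncation _ (spaceGroupDiff_le_wordTruncation_suN N n z hz))

/-- `1` is a fully reduced certificate and an order unit for the cone on the certificate domain. -/
theorem fullCertCone_orderUnit_suN (n : ℕ) :
    (1 : C(LGConfig d (Matrix.specialUnitaryGroup (Fin N) ℂ), ℝ)) ∈ fullCertConeZdSuN (d := d) N β n ∧
      ∀ x ∈ certDomainZdSuN (d := d) N β n, ∃ t : ℝ,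
        t • (1 : C(LGConfig d (Matrix.specialUnitaryGroup (Fin N) ℂ), ℝ)) - x ∈ fullCertConeZdSuN (d := d) N β n :=
  ⟨certCone_le_fullCertCone_suN N β n (one_mem_certCone_words _ n), fun x hx => by
    obtain ⟨t, ht⟩ := (exists_smul_one_sub_mem_certCone (fundamentalLatticeRep N) hx).1
    exact ⟨t, certCone_le_fullCertCone_suN N β n ht⟩⟩

/-! ### Dual feasibility for the fully reduced cone = the fully reduced data -/

/-- A functional invariant on the words of length `≤ 2n` under the three kinds of generators kills
the symmetry multipliers' space. -/
theorem apply_eq_zero_of_mem_spaceGroupDiff_suN {n : ℕ}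
    {φ : C(LGConfig d (Matrix.specialUnitaryGroup (Fin N) ℂ), ℝ) →ₗ[ℝ] ℝ}
    (hinv : ∀ R ∈ fullSpaceGroupMaps d N, ∀ w ∈ wordTruncation (ι := ZdEdge d) (fundamentalLatticeRep N) (n + n),
      φ (w.comp R) = φ w)
    {z : C(LGConfig d (Matrix.specialUnitaryGroup (Fin N) ℂ), ℝ)} (hz : z ∈ spaceGroupDiffZdSuN (d := d) N n) :
    φ z = 0 := by
  induction hz using Submodule.span_induction with
  | mem u hu =>
    obtain ⟨R, hR, w, hw, rfl⟩ := hu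
    rw [map_sub, hinv R hR w hw, sub_self]
  | zero => exact map_zero φ
  | add u u' _ _ hu hu' => rw [map_add, hu, hu', add_zero]
  | smul c u _ hu => rw [map_smul, hu, smul_zero]

/-- The three invariance clauses of `fullSymLevelValuesZdSuN` as invariance under `fullSpaceGroupMaps`. -/
theorem forall_fullSpaceGroupMaps_iff {n : ℕ}
    {φ : C(LGConfig d (Matrix.specialUnitaryGroup (Fin N) ℂ), ℝ) →ₗ[ℝ] ℝ} :
    (∀ R ∈ fullSpaceGroupMaps d N, ∀ w ∈ wordTruncation (ι := ZdEdge d) (fundamentalLatticeRep N) (n + n),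
      φ (w.comp R) = φ w) ↔
      (∀ (v : Fin d → ℤ), ∀ x ∈ wordTruncation (ι := ZdEdge d) (fundamentalLatticeRep N) (n + n),
        φ (x.comp (relabelCM (G := Matrix.specialUnitaryGroup (Fin N) ℂ) (edgeShift v))) = φ x) ∧
      (∀ (σ : Equiv.Perm (Fin d)), ∀ x ∈ wordTruncation (ι := ZdEdge d) (fundamentalLatticeRep N) (n + n),
        φ (x.comp (relabelCM (G := Matrix.specialUnitaryGroup (Fin N) ℂ) (edgePerm σ))) = φ x) ∧
      (∀ (i : Fin d), ∀ x ∈ wordTruncation (ι := ZdEdge d) (fundamentalLatticeRep N) (n + n),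
        φ (x.comp (zdSiteReflectCM (G := Matrix.specialUnitaryGroup (Fin N) ℂ) i)) = φ x) := by
  constructor
  · intro h
    exact ⟨fun v => h _ (Or.inl (Or.inl ⟨v, rfl⟩)), fun σ => h _ (Or.inl (Or.inr ⟨σ, rfl⟩)),
      fun i => h _ (Or.inr ⟨i, rfl⟩)⟩
  · rintro ⟨hT, hperm, hrefl⟩ R ((⟨v, rfl⟩ | ⟨σ, rfl⟩) | ⟨i, rfl⟩)
    · exact hT v
    · exact hperm σ
    · exact hrefl i

/-- ★ **Dual feasibility for the fully reduced cone is exactly the fully reduced data**: non-negative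
on the cone and normalised ⟺ level-`n` feasible and invariant on the words of length `≤ 2n` under
translations, axis permutations and axis reflections. [folklore] -/
theorem isDualFeasible_fullCertCone_iff_suN {n : ℕ}
    {φ : C(LGConfig d (Matrix.specialUnitaryGroup (Fin N) ℂ), ℝ) →ₗ[ℝ] ℝ} :
    IsDualFeasible (fullCertConeZdSuN (d := d) N β n) 1 φ ↔
      IsBootstrapFeasible (fundamentalLatticeRep N) (suExp N)
          (fun e => wilsonBoundaryAction (fundamentalRep (Fin N)) {e}) β
          (wordTruncation (ι := ZdEdge d) (fundamentalLatticeRep N) n) φ ∧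
        ∀ R ∈ fullSpaceGroupMaps d N, ∀ w ∈ wordTruncation (ι := ZdEdge d) (fundamentalLatticeRep N) (n + n),
          φ (w.comp R) = φ w := by
  constructor
  · rintro ⟨hpos, h1⟩
    refine ⟨isBootstrapFeasible_of_isDualFeasible (fundamentalLatticeRep N)
      (wilsonBoundaryAction_polyDeriv_suN N)
      ⟨fun x hx => hpos x (certCone_le_fullCertCone_suN N β n hx), h1⟩, fun R hR w hw => ?_⟩
    have hmem : w.comp R - w ∈ spaceGroupDiffZdSuN (d := d) N n := Submodule.subset_span ⟨R, hR, w, hw, rfl⟩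
    have h₁ := hpos _ (mem_fullCertCone_of_mem_spaceGroupDiff_suN N β hmem)
    have h₂ := hpos _ (mem_fullCertCone_of_mem_spaceGroupDiff_suN N β ((spaceGroupDiffZdSuN N n).neg_mem hmem))
    rw [map_neg] at h₂
    rw [map_sub] at h₁ h₂
    linarith
  · rintro ⟨hφ, hinv⟩
    refine ⟨fun x hx => ?_, hφ.1⟩
    obtain ⟨y, hy, z, hz, rfl⟩ := Submodule.mem_sup.1 hx
    rw [Submodule.restrictScalars_mem] at hz
    rw [map_add, apply_eq_zero_of_mem_spaceGroupDiff_suN N hinv hz, add_zero]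
    exact (hφ.isDualFeasible (fundamentalLatticeRep N)).1 y hy

/-- The fully reduced values as the values of the dual-feasible functionals of the cone. -/
theorem fullSymLevelValuesZd_eq_setOf_isDualFeasible_suN (n : ℕ)
    (P : C(LGConfig d (Matrix.specialUnitaryGroup (Fin N) ℂ), ℝ)) :
    fullSymLevelValuesZdSuN (d := d) N β n P =
      {t | ∃ φ : C(LGConfig d (Matrix.specialUnitaryGroup (Fin N) ℂ), ℝ) →ₗ[ℝ] ℝ,
        IsDualFeasible (fullCertConeZdSuN (d := d) N β n) 1 φ ∧ φ P = t} := by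
  ext t
  constructor
  · rintro ⟨φ, hφ, hT, hperm, hrefl, rfl⟩
    exact ⟨φ, (isDualFeasible_fullCertCone_iff_suN N β).2
      ⟨hφ, (forall_fullSpaceGroupMaps_iff N).2 ⟨hT, hperm, hrefl⟩⟩, rfl⟩
  · rintro ⟨φ, hφ, rfl⟩
    obtain ⟨h1, h2⟩ := (isDualFeasible_fullCertCone_iff_suN N β).1 hφ
    obtain ⟨hT, hperm, hrefl⟩ := (forall_fullSpaceGroupMaps_iff N).1 h2
    exact ⟨φ, h1, hT, hperm, hrefl, rfl⟩

/-- A dual-feasible functional for the fully reduced cone exists. -/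
theorem exists_isDualFeasible_fullCertCone_suN (n : ℕ) :
    ∃ φ : C(LGConfig d (Matrix.specialUnitaryGroup (Fin N) ℂ), ℝ) →ₗ[ℝ] ℝ,
      IsDualFeasible (fullCertConeZdSuN (d := d) N β n) 1 φ := by
  obtain ⟨μ, hμ, hmem⟩ := exists_dlr_integral_mem_fullSymLevelValuesZd (d := d) N β n 1
  rw [fullSymLevelValuesZd_eq_setOf_isDualFeasible_suN] at hmem
  obtain ⟨φ, hφ, -⟩ := hmem
  exact ⟨φ, hφ⟩

/-! ### Soundness -/

/-- ★★ **A fully reduced certificate bounds every fully reduced value.** [folklore] -/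
theorem le_of_mem_fullCertCone_suN {n : ℕ} {P : C(LGConfig d (Matrix.specialUnitaryGroup (Fin N) ℂ), ℝ)} {c : ℝ}
    (hc : c • (1 : C(LGConfig d (Matrix.specialUnitaryGroup (Fin N) ℂ), ℝ)) - P ∈ fullCertConeZdSuN (d := d) N β n) :
    ∀ t ∈ fullSymLevelValuesZdSuN (d := d) N β n P, t ≤ c := by
  intro t ht
  rw [fullSymLevelValuesZd_eq_setOf_isDualFeasible_suN] at ht
  obtain ⟨φ, hφ, rfl⟩ := ht
  exact hφ.le_of_mem_certLevels hc

/-- ★★ **A fully reduced certificate bounds every Gibbs state with the full lattice symmetry** (not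
necessarily the others). [folklore] -/
theorem fullDlr_integral_le_of_mem_fullCertCone_suN {n : ℕ}
    {P : C(LGConfig d (Matrix.specialUnitaryGroup (Fin N) ℂ), ℝ)} {c : ℝ}
    (hc : c • (1 : C(LGConfig d (Matrix.specialUnitaryGroup (Fin N) ℂ), ℝ)) - P ∈ fullCertConeZdSuN (d := d) N β n)
    {μ : Measure (LGConfig d (Matrix.specialUnitaryGroup (Fin N) ℂ))}
    (hμ : μ ∈ ymGibbsMeasures (d := d) (fundamentalRep (Fin N)) β) (hT : IsZdTranslationInvariant μ)
    (hperm : ∀ σ : Equiv.Perm (Fin d), μ.map (relabelConfig (edgePerm σ)) = μ)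
    (hrefl : ∀ i : Fin d, μ.map (configSiteReflect i) = μ) :
    ∫ U, P U ∂μ ≤ c :=
  le_of_mem_fullCertCone_suN N β hc _ (dlr_integral_mem_fullSymLevelValuesZd N β n hμ hT hperm hrefl P)

/-! ### Completeness at a fixed level -/

/-- ★★★ **No duality gap for the fully reduced SDP on `ℤ^d`.** For `P` in the level-`n` certificate
domain: every fully reduced level-`n` value of `P` is `≤ c` iff `(c + ε) • 1 - P` has a fully reduced
certificate for every `ε > 0`. [folklore] -/
theorem forall_fullSymLevelValuesZd_le_iff_suN {n : ℕ}
    {P : C(LGConfig d (Matrix.specialUnitaryGroup (Fin N) ℂ), ℝ)} (hP : P ∈ certDomainZdSuN (d := d) N β n)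
    {c : ℝ} :
    (∀ t ∈ fullSymLevelValuesZdSuN (d := d) N β n P, t ≤ c) ↔
      ∀ ε : ℝ, 0 < ε → (c + ε) • (1 : C(LGConfig d (Matrix.specialUnitaryGroup (Fin N) ℂ), ℝ)) - P ∈
        fullCertConeZdSuN (d := d) N β n := by
  have h := forall_apply_le_iff (certDomainZdSuN (d := d) N β n) (fullCertCone_le_certDomain_suN N β n)
    (fullCertCone_orderUnit_suN N β n).1 (fullCertCone_orderUnit_suN N β n).2
    (exists_isDualFeasible_fullCertCone_suN N β n) hP (c := c)
  rw [← h, fullSymLevelValuesZd_eq_setOf_isDualFeasible_suN]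
  constructor
  · intro h' φ hφ
    exact h' _ ⟨φ, hφ, rfl⟩
  · rintro h' t ⟨φ, hφ, rfl⟩
    exact h' φ hφ

/-- ★★★ **Every constant strictly above the fully reduced level-`n` maximum has an explicit fully
reduced certificate** `c' • 1 - P = σ + ρ + δ`: SOS + rows + symmetry multipliers. [folklore] -/
theorem exists_fullCertificate_suN {n : ℕ}
    {P : C(LGConfig d (Matrix.specialUnitaryGroup (Fin N) ℂ), ℝ)} (hP : P ∈ certDomainZdSuN (d := d) N β n)
    {c c' : ℝ} (h : ∀ t ∈ fullSymLevelValuesZdSuN (d := d) N β n P, t ≤ c) (hc : c < c') :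
    ∃ σ ∈ sosCone (wordTruncation (ι := ZdEdge d) (fundamentalLatticeRep N) n),
      ∃ ρ ∈ rowSpace (fundamentalLatticeRep N) (suExp N)
        (fun e => wilsonBoundaryAction (fundamentalRep (Fin N)) {e}) β
        (wordTruncation (ι := ZdEdge d) (fundamentalLatticeRep N) n),
      ∃ δ ∈ spaceGroupDiffZdSuN (d := d) N n,
        σ + ρ + δ = c' • (1 : C(LGConfig d (Matrix.specialUnitaryGroup (Fin N) ℂ), ℝ)) - P := by
  have h' := (forall_fullSymLevelValuesZd_le_iff_suN N β hP).1 h (c' - c) (sub_pos.2 hc)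
  rw [add_sub_cancel] at h'
  obtain ⟨y, hy, δ, hδ, hsum⟩ := Submodule.mem_sup.1 h'
  obtain ⟨σ, hσ, ρ, hρ, rfl⟩ := (mem_certCone_iff (fundamentalLatticeRep N)).1 hy
  rw [Submodule.restrictScalars_mem] at hδ
  exact ⟨σ, hσ, ρ, hρ, δ, hδ, hsum⟩

/-- ★★ **The fully reduced maximum equals the infimum of the fully-reduced-certified constants.** -/
theorem sSup_fullSymLevelValuesZd_eq_sInf_suN {n : ℕ}
    {P : C(LGConfig d (Matrix.specialUnitaryGroup (Fin N) ℂ), ℝ)} (hP : P ∈ certDomainZdSuN (d := d) N β n) :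
    sSup (fullSymLevelValuesZdSuN (d := d) N β n P) =
      sInf {c : ℝ | c • (1 : C(LGConfig d (Matrix.specialUnitaryGroup (Fin N) ℂ), ℝ)) - P ∈ fullCertConeZdSuN (d := d) N β n} := by
  rw [fullSymLevelValuesZd_eq_setOf_isDualFeasible_suN]
  exact sSup_eq_sInf (certDomainZdSuN (d := d) N β n) (fullCertCone_le_certDomain_suN N β n)
    (fullCertCone_orderUnit_suN N β n).1 (fullCertCone_orderUnit_suN N β n).2
    (exists_isDualFeasible_fullCertCone_suN N β n) hP

/-! ### Completeness for the fully symmetric phases -/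

/-- ★★★ **Every polynomial bound strictly valid in all Gibbs states with the full lattice symmetry has
a fully reduced certificate at some level.** `SU(N)` on `ℤ^d`, any real `β`: if `∫ P dμ ≤ c₀` for
every DLR state `μ` invariant under translations, axis permutations and axis reflections, and
`c₀ < c`, then for some `n`, `c • 1 - P ∈ fullCertConeZdSuN N β n`. [folklore] -/
theorem exists_fullCertificate_of_forall_fullDlr_le_suN
    {P : C(LGConfig d (Matrix.specialUnitaryGroup (Fin N) ℂ), ℝ)}
    (hP : P ∈ polyAlgebra (ι := ZdEdge d) (fundamentalLatticeRep N)) {c₀ c : ℝ}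
    (h : ∀ μ ∈ ymGibbsMeasures (d := d) (fundamentalRep (Fin N)) β, IsZdTranslationInvariant μ →
      (∀ σ : Equiv.Perm (Fin d), μ.map (relabelConfig (edgePerm σ)) = μ) →
        (∀ i : Fin d, μ.map (configSiteReflect i) = μ) → ∫ U, P U ∂μ ≤ c₀) (hc : c₀ < c) :
    ∃ n, c • (1 : C(LGConfig d (Matrix.specialUnitaryGroup (Fin N) ℂ), ℝ)) - P ∈ fullCertConeZdSuN (d := d) N β n := by
  obtain ⟨hIne, hIbdd, -⟩ := fullDlrValues_nonempty_bdd_suN (d := d) N β P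
  have hS : sSup (fullDlrValuesSuN (d := d) N β P) ≤ c₀ := by
    refine csSup_le hIne ?_
    rintro t ⟨μ, hμ, hT, hperm, hrefl, rfl⟩
    exact h μ hμ hT hperm hrefl
  have hlt : sSup (fullDlrValuesSuN (d := d) N β P) < (c₀ + c) / 2 := by linarith
  have hev := (tendsto_sSup_fullSymLevelValuesZd_suN N β hP).eventually (Iio_mem_nhds hlt)
  obtain ⟨n, hn₁, hn₂⟩ := (hev.and (eventually_mem_certDomainZd_suN N β hP)).exists
  obtain ⟨hbdd, -, -⟩ := bdd_fullSymLevelValuesZd_suN N β hn₂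
  refine ⟨n, ?_⟩
  have hle : ∀ t ∈ fullSymLevelValuesZdSuN (d := d) N β n P, t ≤ (c₀ + c) / 2 := fun t ht =>
    (le_csSup hbdd ht).trans (le_of_lt hn₁)
  have h' := (forall_fullSymLevelValuesZd_le_iff_suN N β hn₂).1 hle (c - (c₀ + c) / 2) (by linarith)
  rwa [add_sub_cancel] at h'

end ZdSuN

end Summit.QuantumFields.GaugeBoot

end
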